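import Literature.MathematicalPhysics.QuantumFieldTheory.Balaban1983to89.UnitaryModel
import HarnessLib

/-!
# `AlphaInputsT3ACv3ReseedGauge` — (r1-σ), the EXTENSION letter (σ-C): **RE-SEEDING A FLAT GAUGE ACROSS AN INTERFACE WITHOUT GLUING LOSS** — given a gauge `σ₁` (flat on the bonds of a layer `F`)
# and a gauge `g` flat on a box `B⁺ ⊇ F` (e.g. the comb gauge of `B⁺`), the RE-SEEDED gauge `reseed σ₁ g π (x) := σ₁(πx)·g(πx)⁻¹·g(x)` (`π` = the coordinate projection onto the layer) EQUALS `σ₁`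
# on `F`, and on every bond `b` of `B⁺`: `dist1(U^{reseed}(b)) = dist1(U^{g}(b))` if `b` is NORMAL to the layer, `≤ dist1(U^g(b)) + dist1(U^g(πb)) + dist1(U^{σ₁}(πb))` if TANGENTIAL — so a flat gauge
# propagates box by box along any FACE-CHAIN of cells with ADDITIVE (not multiplicative, not `O(ρ)`) loss: the cut hexagonal ring of (r1-cone) included — cell `ym3-torus`, width seat
# `ym-ust-19936-w2` (g2), completing row (r1-σ) («η′-flat fine gauge on a face-connected union of Ω-cells from plaquette bounds») beyond the down-closed shapes of `…StencilGauge`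

WHY (★★OWNER 02:48:44Z (1): (r1-cone) OF RECORD := the LEAD's exact cut-face device «σ_c η′-flat on the CUT ring, which is simply connected ⇒ exists with no backbone»; ★w1-19936 g2 LEAD 02:22:38Z
(r1-σ)).  `…StencilGauge` (⧗ p599217) flattens every union of boxes anchored at ONE corner (face ∕ inward edge ∕ inward vertex shapes) with one comb gauge.  The cut ring `(2×2×2 octants) ∖
(two opposite octants)` is not of that kind (its low corner is missing), but it is a FACE-CHAIN of six octant boxes `B₁, …, B₆` (cut between `B₆` and `B₁`).  Naive chaining — comb gauge on
each box, matched by a constant at one point of the interface — loses `O(side·η) = O(Bε)` on the interface (the relative rotation of two flat gauges drifts by `η₁ + η₂` per bond, ★w4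
`RelativeGauge.norm_relGauge_tgt_sub_src_le`), which is the k-NONUNIFORM number L-3 forbids.  RE-SEEDING avoids it: keep `σ₁` on the last layer `F` of `B_j`, take ANY gauge `g` flat on the
box `B⁺ = F ∪ B_{j+1}` (one comb, `RegionAxialGauge`∕`StencilGauge`), and set `σ := σ₁(π·)·g(π·)⁻¹·g` on `B⁺`, `π` the projection onto `F` along the normal `n`.  Then `U^{σ}(b) =
T(πb₋)·U^{g}(b)·T(πb₊)⁻¹` with `T := σ₁·g⁻¹` on `F`; a normal bond has `πb₊ = πb₋` (pure conjugation: no loss at all), a tangential bond has `πb₊ = (πb₋) + e_τ` and the ledger identity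
`T(p + e_τ) = U^{σ₁}(πb)⁻¹·T(p)·U^{g}(πb)` (★w4 `RelativeGauge.relGauge_tgt_eq`) turns `T(πb₋)·U^g(b)·T(πb₊)⁻¹` into `Ad_{T(p)}(U^g(b)·U^g(πb)⁻¹)·U^{σ₁}(πb)`: three flat factors.  Iterating
along the chain: `η_{j+1} ≤ 2·η_comb(B⁺_{j+1}) + η_j`, i.e. `η₆ ≤ η_comb(B₁) + 10·η_comb` — ADDITIVE in the number of cells, every term `O(side·δ) = O(η′)`.
WHAT.  §1 (any `GaugeGroup`, any idempotent-free "projection" `π : Site → Site`): def `reseed`, `reseed_of_fix` (`πx = x ⇒ σ = σ₁`), `gaugeAct_reseed` (the `T·U^g·T⁻¹` form), ★ `dist1_gaugeAct_reseed_of_normal`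
(`π b₊ = π b₋`: equality), ★★ `dist1_gaugeAct_reseed_le_of_tangential` (`π b₊ = (π b₋) + e_{dir b}`: the three-term bound); §2 the coordinate projection `projTo n a x := update x n a`
(`projTo_apply_same/_ne`, `projTo_of_eq`, `projTo_shift_same`, `projTo_shift_ne`) and the bond-sorted corollaries `dist1_gaugeAct_reseed_projTo_eq` (bonds of direction `n`),
`dist1_gaugeAct_reseed_projTo_le` (bonds of direction `≠ n`); §3 the `SU(n)` operator-norm reading ★ `norm_gaugeAct_reseed_projTo_sub_one_le` (`≤ 2η + η₁`).
HONEST FRAMING.  Group algebra (`group`) and `Function.update` bookkeeping; no analysis, no smallness.  Count-neutral helper toward the (FL) row of 2′∕2′χ (`--supports stmt-QuantumFields-19936`);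
the chain instantiation for the cut ring (which boxes, which layers) is the consumer's ((S5)∕(r1-cone)); (FL)∕`hLift`, the stub, the crux and the gap are NOT claimed; registry untouched.
YM₃ on the three-torus is RUNG R3 of the programme, not the Clay problem.

References: T. Bałaban, Commun. Math. Phys. 98 (1985) 17–51 [Balaban1985Averaging] ((8) p.18, (19) p.21, pp.24–25); Commun. Math. Phys. 99 (1985) 75–102 [Balaban1985RegularSpaces] (Lemma 1 (1.25) p.79).
-/

set_option autoImplicit false

noncomputable section

open scoped Matrix.Norms.L2Operator

namespace Summit.QuantumFields.YangMills.Theorems.ReseedGauge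

open Literature.MathematicalPhysics.QuantumFieldTheory.Balaban1983to89

variable {P : Params} {j : ℕ} {G : Type*} [GaugeGroup G]

/-! ## §1 Re-seeding a gauge through a projection -/

/-- **THE RE-SEEDED GAUGE** `reseed σ₁ g π (x) := σ₁(πx)·g(πx)⁻¹·g(x)`: `g` corrected on the left by the relative rotation `T = σ₁g⁻¹` read at the projected site. [cite: Balaban1985Averaging, (8) p.18] -/
def reseed (σ₁ g : GaugeTransf P j G) (π : Site P j → Site P j) : GaugeTransf P j G :=
  fun x => σ₁ (π x) * (g (π x))⁻¹ * g x

/-- `reseed` unfolded. [folklore] -/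
theorem reseed_apply (σ₁ g : GaugeTransf P j G) (π : Site P j → Site P j) (x : Site P j) : reseed σ₁ g π x = σ₁ (π x) * (g (π x))⁻¹ * g x := rfl

/-- **ON THE SEED LAYER THE RE-SEEDED GAUGE IS `σ₁`** (`πx = x`). [folklore] -/
theorem reseed_of_fix (σ₁ g : GaugeTransf P j G) (π : Site P j → Site P j) {x : Site P j} (hx : π x = x) : reseed σ₁ g π x = σ₁ x := by
  rw [reseed_apply, hx]; group

/-- **THE RE-SEEDED BOND VARIABLE**: `U^{reseed}(b) = T(πb₋)·U^{g}(b)·T(πb₊)⁻¹` with `T(p) = σ₁(p)·g(p)⁻¹`. [cite: Balaban1985Averaging, (8) p.18] -/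
theorem gaugeAct_reseed (σ₁ g : GaugeTransf P j G) (π : Site P j → Site P j) (U : GaugeField P j G) (b : PBond P j) :
    GaugeField.gaugeAct (reseed σ₁ g π) U b =
      (σ₁ (π b.src) * (g (π b.src))⁻¹) * GaugeField.gaugeAct g U b * (σ₁ (π b.tgt) * (g (π b.tgt))⁻¹)⁻¹ := by
  simp only [GaugeField.gaugeAct, reseed_apply]; group

/-- **★ NORMAL BONDS LOSE NOTHING**: if `π b₊ = π b₋` then `dist1(U^{reseed}(b)) = dist1(U^{g}(b))` (pure conjugation). [cite: Balaban1985Averaging, (19) p.21] -/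
theorem dist1_gaugeAct_reseed_of_normal (σ₁ g : GaugeTransf P j G) (π : Site P j → Site P j) (U : GaugeField P j G) (b : PBond P j) (hb : π b.tgt = π b.src) :
    dist1 (GaugeField.gaugeAct (reseed σ₁ g π) U b) = dist1 (GaugeField.gaugeAct g U b) := by
  rw [gaugeAct_reseed, hb]
  exact GaugeGroup.dist1_conj _ _

/-- **★★ TANGENTIAL BONDS LOSE ONLY THE THREE FLATNESS DEFECTS**: if `π b₊ = (π b₋) + e_{dir b}` (the projected bond `πb = ⟨π b₋, dir b⟩` lies in the seed layer) then
`dist1(U^{reseed}(b)) ≤ dist1(U^{g}(b)) + dist1(U^{g}(πb)) + dist1(U^{σ₁}(πb))` — by the ledger identity `T(πb₊) = U^{σ₁}(πb)⁻¹·T(πb₋)·U^{g}(πb)`: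
`U^{reseed}(b) = Ad_{T(πb₋)}(U^g(b)·U^g(πb)⁻¹)·U^{σ₁}(πb)`. [cite: Balaban1985Averaging, (19) p.21; Balaban1985RegularSpaces, Lemma 1 (1.25) p.79] -/
theorem dist1_gaugeAct_reseed_le_of_tangential (σ₁ g : GaugeTransf P j G) (π : Site P j → Site P j) (U : GaugeField P j G) (b : PBond P j)
    (hb : π b.tgt = (π b.src).shift b.dir) :
    dist1 (GaugeField.gaugeAct (reseed σ₁ g π) U b) ≤
      dist1 (GaugeField.gaugeAct g U b) + dist1 (GaugeField.gaugeAct g U ⟨π b.src, b.dir⟩) + dist1 (GaugeField.gaugeAct σ₁ U ⟨π b.src, b.dir⟩) := by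
  set p : Site P j := π b.src with hp
  set T : G := σ₁ p * (g p)⁻¹ with hT
  set Wg : G := GaugeField.gaugeAct g U b with hWg
  set Fg : G := GaugeField.gaugeAct g U ⟨p, b.dir⟩ with hFg
  set F1 : G := GaugeField.gaugeAct σ₁ U ⟨p, b.dir⟩ with hF1
  -- the re-seeded bond variable in the three-factor form
  have e : GaugeField.gaugeAct (reseed σ₁ g π) U b = T * (Wg * Fg⁻¹) * T⁻¹ * F1 := by
    have htgt : (⟨p, b.dir⟩ : PBond P j).tgt = p.shift b.dir := rfl
    rw [gaugeAct_reseed, hb, ← hp, ← hT, ← hWg, hFg, hF1]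
    simp only [GaugeField.gaugeAct, htgt, hT]
    group
  rw [e]
  calc dist1 (T * (Wg * Fg⁻¹) * T⁻¹ * F1) ≤ dist1 (T * (Wg * Fg⁻¹) * T⁻¹) + dist1 F1 := GaugeGroup.dist1_mul_le _ _
    _ = dist1 (Wg * Fg⁻¹) + dist1 F1 := by rw [GaugeGroup.dist1_conj]
    _ ≤ dist1 Wg + dist1 Fg + dist1 F1 := by
        have h := GaugeGroup.dist1_mul_le Wg Fg⁻¹
        rw [GaugeGroup.dist1_inv] at h
        linarith

/-! ## §2 The coordinate projection onto a layer `{x_n = a}` -/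

/-- **THE PROJECTION ONTO THE LAYER `{x_n = a}` ALONG THE NORMAL `n`**: `projTo n a x := x` with its `n`-th coordinate set to `a`. [folklore] -/
def projTo (n : Fin P.d) (a : ZMod (P.sitesPerDir j)) (x : Site P j) : Site P j := Function.update x n a

/-- The normal coordinate of the projection is `a`. [folklore] -/
@[simp] theorem projTo_apply_same (n : Fin P.d) (a : ZMod (P.sitesPerDir j)) (x : Site P j) : projTo n a x n = a := by
  simp [projTo]

/-- The tangential coordinates are unchanged. [folklore] -/
theorem projTo_apply_ne (n : Fin P.d) (a : ZMod (P.sitesPerDir j)) (x : Site P j) {κ : Fin P.d} (h : κ ≠ n) : projTo n a x κ = x κ := by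
  simp [projTo, h]

/-- Sites of the layer are fixed. [folklore] -/
theorem projTo_of_eq (n : Fin P.d) (a : ZMod (P.sitesPerDir j)) {x : Site P j} (hx : x n = a) : projTo n a x = x := by
  rw [projTo, ← hx, Function.update_eq_self]

/-- The projection is idempotent. [folklore] -/
theorem projTo_projTo (n : Fin P.d) (a : ZMod (P.sitesPerDir j)) (x : Site P j) : projTo n a (projTo n a x) = projTo n a x :=
  projTo_of_eq n a (projTo_apply_same n a x)

/-- **A NORMAL STEP IS INVISIBLE TO THE PROJECTION**: `π(x + e_n) = π(x)`. [folklore] -/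
theorem projTo_shift_same (n : Fin P.d) (a : ZMod (P.sitesPerDir j)) (x : Site P j) : projTo n a (x.shift n) = projTo n a x := by
  simp [projTo, Site.shift]

/-- **A TANGENTIAL STEP COMMUTES WITH THE PROJECTION**: `π(x + e_τ) = π(x) + e_τ` for `τ ≠ n`. [folklore] -/
theorem projTo_shift_ne (n : Fin P.d) (a : ZMod (P.sitesPerDir j)) (x : Site P j) {τ : Fin P.d} (h : τ ≠ n) : projTo n a (x.shift τ) = (projTo n a x).shift τ := by
  simp only [projTo, Site.shift]
  rw [Function.update_comm h, Function.update_of_ne h]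

/-- **BONDS ALONG THE NORMAL**: `dist1(U^{reseed σ₁ g (projTo n a)}⟨x, n⟩) = dist1(U^{g}⟨x, n⟩)`. [cite: Balaban1985Averaging, (19) p.21] -/
theorem dist1_gaugeAct_reseed_projTo_eq (σ₁ g : GaugeTransf P j G) (n : Fin P.d) (a : ZMod (P.sitesPerDir j)) (U : GaugeField P j G) (x : Site P j) :
    dist1 (GaugeField.gaugeAct (reseed σ₁ g (projTo n a)) U ⟨x, n⟩) = dist1 (GaugeField.gaugeAct g U ⟨x, n⟩) :=
  dist1_gaugeAct_reseed_of_normal σ₁ g (projTo n a) U ⟨x, n⟩ (projTo_shift_same n a x)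

/-- **BONDS ACROSS THE NORMAL** (`τ ≠ n`): `dist1(U^{reseed σ₁ g (projTo n a)}⟨x, τ⟩) ≤ dist1(U^{g}⟨x, τ⟩) + dist1(U^{g}⟨πx, τ⟩) + dist1(U^{σ₁}⟨πx, τ⟩)` — the projected bond `⟨πx, τ⟩` lies in
the layer `{x_n = a}`. [cite: Balaban1985Averaging, (19) p.21; Balaban1985RegularSpaces, Lemma 1 (1.25) p.79] -/
theorem dist1_gaugeAct_reseed_projTo_le (σ₁ g : GaugeTransf P j G) (n : Fin P.d) (a : ZMod (P.sitesPerDir j)) (U : GaugeField P j G) (x : Site P j) {τ : Fin P.d} (hτ : τ ≠ n) :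
    dist1 (GaugeField.gaugeAct (reseed σ₁ g (projTo n a)) U ⟨x, τ⟩) ≤
      dist1 (GaugeField.gaugeAct g U ⟨x, τ⟩) + dist1 (GaugeField.gaugeAct g U ⟨projTo n a x, τ⟩) + dist1 (GaugeField.gaugeAct σ₁ U ⟨projTo n a x, τ⟩) :=
  dist1_gaugeAct_reseed_le_of_tangential σ₁ g (projTo n a) U ⟨x, τ⟩ (projTo_shift_ne n a x hτ)

/-! ## §3 The `SU(n)` operator-norm reading -/

section SU

variable {m : Type*} [Fintype m] [DecidableEq m] [Nonempty m]

/-- **★ THE RE-SEEDED GAUGE FOR `SU(n)`**: if `g` is `η`-flat at `⟨x, τ⟩` and at its projection `⟨πx, τ⟩`, and `σ₁` is `η₁`-flat at `⟨πx, τ⟩` (a bond of the seed layer), then the re-seeded gauge is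
`(2η + η₁)`-flat at `⟨x, τ⟩` (`τ ≠ n`); along the normal it is exactly as flat as `g` (`dist1_gaugeAct_reseed_projTo_eq`).  Operator norm, `dist1 = ‖· − 1‖_op` by `rfl`.
[cite: Balaban1985Averaging, (19) p.21; Balaban1985RegularSpaces, Lemma 1 (1.25) p.79] -/
theorem norm_gaugeAct_reseed_projTo_sub_one_le (σ₁ g : GaugeTransf P j (Matrix.specialUnitaryGroup m ℂ)) (n : Fin P.d) (a : ZMod (P.sitesPerDir j))
    (U : GaugeField P j (Matrix.specialUnitaryGroup m ℂ)) (x : Site P j) {τ : Fin P.d} (hτ : τ ≠ n) {η η₁ : ℝ}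
    (hg : ‖((GaugeField.gaugeAct g U ⟨x, τ⟩ : Matrix.specialUnitaryGroup m ℂ) : Matrix m m ℂ) - 1‖ ≤ η)
    (hgπ : ‖((GaugeField.gaugeAct g U ⟨projTo n a x, τ⟩ : Matrix.specialUnitaryGroup m ℂ) : Matrix m m ℂ) - 1‖ ≤ η)
    (h₁ : ‖((GaugeField.gaugeAct σ₁ U ⟨projTo n a x, τ⟩ : Matrix.specialUnitaryGroup m ℂ) : Matrix m m ℂ) - 1‖ ≤ η₁) :
    ‖((GaugeField.gaugeAct (reseed σ₁ g (projTo n a)) U ⟨x, τ⟩ : Matrix.specialUnitaryGroup m ℂ) : Matrix m m ℂ) - 1‖ ≤ 2 * η + η₁ := by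
  have h := dist1_gaugeAct_reseed_projTo_le σ₁ g n a U x hτ
  have e : ∀ V : Matrix.specialUnitaryGroup m ℂ, dist1 V = ‖(V : Matrix m m ℂ) - 1‖ := fun V => rfl
  rw [e, e, e, e] at h
  linarith

/-- Along the normal, `SU(n)` spelling: `‖U^{reseed}⟨x, n⟩ − 1‖ = ‖U^{g}⟨x, n⟩ − 1‖`. [cite: Balaban1985Averaging, (19) p.21] -/
theorem norm_gaugeAct_reseed_projTo_sub_one_eq (σ₁ g : GaugeTransf P j (Matrix.specialUnitaryGroup m ℂ)) (n : Fin P.d) (a : ZMod (P.sitesPerDir j))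
    (U : GaugeField P j (Matrix.specialUnitaryGroup m ℂ)) (x : Site P j) :
    ‖((GaugeField.gaugeAct (reseed σ₁ g (projTo n a)) U ⟨x, n⟩ : Matrix.specialUnitaryGroup m ℂ) : Matrix m m ℂ) - 1‖ =
      ‖((GaugeField.gaugeAct g U ⟨x, n⟩ : Matrix.specialUnitaryGroup m ℂ) : Matrix m m ℂ) - 1‖ :=
  dist1_gaugeAct_reseed_projTo_eq σ₁ g n a U x

end SU

end Summit.QuantumFields.YangMills.Theorems.ReseedGauge

end
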